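import Mathlib
import Summits.BirchSwinnertonDyer.BirchSwinnertonDyer.Theorems.ManinLocalTwoThreeOddDegreeCuspZeroNonvanishing
import Literature.NumberTheory.EllipticCurves.CuspFormLFunctionAnalyticRankProofs
import Literature.NumberTheory.EllipticCurves.AnalyticRankOrderProofs
import HarnessLib

/-!
# Odd modular degree at level `4p` forces analytic rank `0`

Summit `BirchSwinnertonDyer`, sub-problem `BirchSwinnertonDyer`, route `ManinLocalTwoThree`; width seat `bsd-line-manin23-p2`
(gen 9), `--supports` the crux C2 `ManinOddAtFour` (stmt-BirchSwinnertonDyer-22967).  E-facing wrapper of the seat's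
`lValue_one_ne_zero_of_odd_deg` (p659323: at `N = 4p`, `p` an odd prime, an odd-degree `X₀(4p)`-parametrisation of ANY elliptic
`W/ℚ` has `{∞,0}_f ≠ 0`): wired to the curve's entire `L`-function (`IsNewformOf.hasEntireLFunction`,
`entireLFunction_eq_LSeries`, `IsNewformOf.cuspFormLSeries_eq`) and to `analyticRank_eq_zero_iff_holds`.

PROVED here (no `sorry`): **`entireLFunction_one_ne_zero_of_odd_deg`** (`L(W,1) ≠ 0`) and
**`analyticRank_eq_zero_of_odd_deg`** (`ord_{s=1} L(W,s) = 0`) for every `W`, every odd prime `p`, every datum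
`D : ModularParametrizationData W (4p)` with `Odd D.deg`.
BSD is not proved by this; Manin's conjecture is not proved by this.
-/

set_option autoImplicit false
set_option linter.dupNamespace false

noncomputable section

open scoped MatrixGroups ModularForm
open CongruenceSubgroup
open Literature.NumberTheory.EllipticCurves Literature.NumberTheory.EllipticCurves.ModularForms

namespace Summit.BirchSwinnertonDyer.BirchSwinnertonDyer.Theorems.ManinLocalTwoThree

/-- **`L(W, 1) ≠ 0` for an odd-degree `X₀(4p)`-parametrisation** (`p` an odd prime; any model `W`, any datum): the entire
continuation `W.entireLFunction` agrees with `L(f_D, s)` on `re s > 2`, so `lValue_one_ne_zero_of_odd_deg` applies to it. -/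
theorem entireLFunction_one_ne_zero_of_odd_deg {W : WeierstrassCurve ℚ} [W.IsElliptic] {p : ℕ} [NeZero (4 * p)]
    (hp : p.Prime) (hp2 : p ≠ 2) (D : ModularParametrizationData W (4 * p)) (hodd : Odd D.deg) :
    W.entireLFunction 1 ≠ 0 :=
  lValue_one_ne_zero_of_odd_deg hp hp2 D hodd (W.differentiable_entireLFunction D.isNewformOf.hasEntireLFunction)
    fun s hs => by
      rw [W.entireLFunction_eq_LSeries D.isNewformOf.hasEntireLFunction (by linarith), D.isNewformOf.cuspFormLSeries_eq]

/-- **Odd modular degree at level `4p` ⟹ analytic rank `0`** (`p` an odd prime; any model `W`, any datum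
`D : ModularParametrizationData W (4p)`): `ord_{s=1} L(W, s) = 0`. -/
theorem analyticRank_eq_zero_of_odd_deg {W : WeierstrassCurve ℚ} [W.IsElliptic] {p : ℕ} [NeZero (4 * p)]
    (hp : p.Prime) (hp2 : p ≠ 2) (D : ModularParametrizationData W (4 * p)) (hodd : Odd D.deg) :
    W.analyticRank = 0 :=
  (WeierstrassCurve.analyticRank_eq_zero_iff_holds (W := W) D.isNewformOf.hasEntireLFunction).mpr
    (entireLFunction_one_ne_zero_of_odd_deg hp hp2 D hodd)

end Summit.BirchSwinnertonDyer.BirchSwinnertonDyer.Theorems.ManinLocalTwoThree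

end
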